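import Summits.BirchSwinnertonDyer.BirchSwinnertonDyer.Theorems.AdditiveKolyvaginRoadLevelSystemsCoreConnected
import Summits.BirchSwinnertonDyer.BirchSwinnertonDyer.Theorems.AdditiveKolyvaginRoadKolyvaginPrimitiveAdditiveParityOfLevelInputs
import Summits.BirchSwinnertonDyer.BirchSwinnertonDyer.Theorems.AdditiveKolyvaginRoadEigen
import Summits.BirchSwinnertonDyer.BirchSwinnertonDyer.Theses.AdditiveKolyvaginRoad
import HarnessLib

/-!
# Route `AdditiveKolyvaginRoad`, crux `LevelKolyvaginSystemsAdditive` (item stmt-BirchSwinnertonDyer-21396, KS′):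
# THE CRUX BY NAME from a bipartite SEED datum, granted PUB ∕ DUAL and witness-free one-prime raising (R′)
# (cell `pub/bsd-wall`, width seat `bsd-wall-akr-p2x-w2` g2; `--supports stmt-BirchSwinnertonDyer-21396`, helper; part 8 = the
# by-name socket of the rigidity chain `…RigidityCore` ∕ `…Rigidity` ∕ `…OfIgnition` ∕ `…RigidityDichotomy` ∕
# `…RigidityConnected` ∕ `…CoreConnected` ∕ `…OfSeedAtFrame` ∕ `…RigidityCongruences`; companion of w2 g0's
# `levelKolyvaginSystemsAdditive_of_bipartite` (p581264), whose rank-0 ANCHOR AT EVERY ODD LEVEL is replaced by ONE seed)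

WHAT. `levelKolyvaginSystemsAdditive_of_seed`: the route's crux `LevelKolyvaginSystemsAdditive` (KS′, BY NAME) FOLLOWS from
three displayed ∀-frame hypotheses and the route's two bundles of published inputs:
* `PublishedInputsAdditiveKoly`, `PublishedDualityInputsAdditiveKoly` (BY NAME; used only for the parity of `dim Sel_p(E/K)`:
  Gross–Zagier, Kolyvagin, modularity, levelwise Cassels–Tate);
* (R′) WITNESS-FREE ONE-PRIME RAISING at every frame (W. Zhang Lemma 5.3 raising half with the sign of `q` read through
  (Equiv); E-side, Poitou–Tate; the tree's (R) `selQP_raise_of_admQ` is it with a Kummer witness — sibling seat akr-p2x-w3 g3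
  is landing the witness-free local form `…ToricTransLocal` ∕ `…AdmissibleRaiseFree`);
* the SEED DATUM at every ♯ additive frame: signs `ε₀`, EVEN-level classes `κ₀` with the realisation identity and the carrier's
  local axioms, ODD-level values `λ`, the Bertolini–Darmon laws (A), (B) TWO-SIDED, `selmer_bottom` (the conductor-one bottom
  class is a signed Selmer class), and ONE SEED at a level of total canonical rank `≤ 1` (a non-zero conductor-one class at an
  even level OR a unit value `λ(∅, n₀)` at an odd level).
So KS′ asks, beyond E-side inputs that are standard (PUB, DUAL, (R′)): W. Zhang's bipartite system at `p²`-level with two-sided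
laws (K1 + the multiplicity-one input) and ONE seed — no rank-0 anchor at every level. Proof = part 5's
`nonempty_levelKolyvaginSystemP_of_bipartite_of_seed_at_frame` with the parity binder discharged as in part 6.

HONEST FRAMING: one theorem; 0 definitions, 0 named facts, 0 `sorry`; CONDITIONAL (all hypotheses displayed); closes nothing
— the seed datum at `p² ∣ N` is the crux's open content. BSD is not proved by any of this.

References: [cite: Howard2006Bipartite, Prop. 2.4.11, Thm. 2.5.1] [cite: WZhang2014, §3, Thm. 4.3, (4.8), Lemma 5.3, Prop. 5.4,
Thm. 7.2, Thm. 9.2, §9] [cite: BertoliniDarmon2005, Thm. 4.1, Thm. 4.2] [cite: GrossLMS1991, §10].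
-/

-- single-conjunct summit: `Summit.BirchSwinnertonDyer.BirchSwinnertonDyer.…` repeats the name by design
set_option linter.dupNamespace false

noncomputable section

open scoped Classical

namespace Summit.BirchSwinnertonDyer.BirchSwinnertonDyer.Theorems.AdditiveKoly

open WeierstrassCurve NumberField IsDedekindDomain
  Literature.NumberTheory.EllipticCurves Literature.NumberTheory.EllipticCurves.ModularForms
  Literature.NumberTheory.EllipticCurves.Rank1Residual Literature.NumberTheory.GaloisRepresentations Module
  Summit.BirchSwinnertonDyer.Rank1Residual.X11b.Three.Koly
  Summit.BirchSwinnertonDyer.BirchSwinnertonDyer.Theses.AdditiveKolyvaginRoad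

/-- **KS′ BY NAME FROM A SEED DATUM, granted PUB ∕ DUAL and (R′).** If (R′) witness-free one-prime raising holds for the
canonical spaces of every `(E, K, p, c)` with `K` imaginary quadratic and `c ≠ 1`, and at every ♯ additive frame of the route
and every complex conjugation `c ≠ 1` there is a SEED DATUM — signs, even-level classes with the realisation identity and the
local Kolyvagin-system axioms at even non-empty levels, odd-level values, the laws (A), (B) two-sided, the bottom class a signed
Selmer class, and ONE seed at a level of total canonical rank `≤ 1` — then, granted `PublishedInputsAdditiveKoly` and
`PublishedDualityInputsAdditiveKoly`, the crux `LevelKolyvaginSystemsAdditive` holds. [cite: WZhang2014, §3, Thm. 4.3, Thm. 7.2,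
Thm. 9.2, §9] [cite: Howard2006Bipartite, Thm. 2.5.1] [cite: BertoliniDarmon2005, Thm. 4.1, Thm. 4.2] -/
theorem levelKolyvaginSystemsAdditive_of_seed (hPUB : PublishedInputsAdditiveKoly)
    (hDual : PublishedDualityInputsAdditiveKoly)
    (hR : ∀ (W : WeierstrassCurve ℚ) [W.IsElliptic] [W.IsGloballyMinimal] (p : ℕ) [Fact p.Prime]
      (K : Type) [Field K] [NumberField K] (c : K ≃ₐ[ℚ] K) [Module (ZMod p) (Vp W K p)],
      5 ≤ p → IsImaginaryQuadratic K → c ≠ 1 →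
      ∀ (m : Finset (AdmQ W K p)) (q : AdmQ W K p) (μ : Bool), q ∉ m →
      (∀ v : HeightOneSpectrum (𝓞 K), ((q : ℕ) : 𝓞 K) ∈ v.asIdeal → ∀ z : Vp W K p,
        (W.baseChange K).torsionLocMap (v.adicCompletion K) ((p ^ 1 : ℕ) : ℤ) (conjAct W c ((p ^ 1 : ℕ) : ℤ) z) =
          sgnP μ • (W.baseChange K).torsionLocMap (v.adicCompletion K) ((p ^ 1 : ℕ) : ℤ) z) →
      (∀ x ∈ SelQP W K p c m μ, ∀ v : HeightOneSpectrum (𝓞 K), ((q : ℕ) : 𝓞 K) ∈ v.asIdeal →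
        x ∈ (W.baseChange K).torsionLocalKer (v.adicCompletion K) ((p ^ 1 : ℕ) : ℤ)) →
      SelQP W K p c m μ ≤ SelQP W K p c (insert q m) μ ∧
        finrank (ZMod p) (SelQP W K p c (insert q m) μ) = finrank (ZMod p) (SelQP W K p c m μ) + 1)
    (H : ∀ (W : WeierstrassCurve ℚ) [W.IsElliptic] [W.IsGloballyMinimal] [NeZero (W.conductorNorm ℤ)]
      (p : ℕ) [Fact p.Prime] (K : Type) [Field K] [NumberField K]
      (Dt : ModularParametrizationData W (W.conductorNorm ℤ)) (β : ℤ) (ι : K →+* ℂ),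
      5 ≤ p → Addv W p → W.HasSurjectiveModNGaloisRep p →
      (∀ (ℓ : ℕ) [Fact ℓ.Prime], W.HasMultiplicativeReductionAtPrime ℓ →
        ¬ p ∣ padicValInt ℓ W.minimalDiscriminantInt) →
      (∃ (ℓ₁ ℓ₂ : ℕ) (_ : Fact ℓ₁.Prime) (_ : Fact ℓ₂.Prime), ℓ₁ ≠ ℓ₂ ∧
        W.HasMultiplicativeReductionAtPrime ℓ₁ ∧ W.HasMultiplicativeReductionAtPrime ℓ₂) →
      ¬ p ∣ W.tamagawaProduct → W.analyticRank = 1 →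
      IsImaginaryQuadratic K → Odd (NumberField.discr K) → NumberField.discr K < -4 →
      SatisfiesHeegnerHypothesis (W.conductorNorm ℤ) K →
      (W.quadraticTwist (NumberField.discr K : ℚ)).entireLFunction 1 ≠ 0 →
      (4 * (W.conductorNorm ℤ : ℤ)) ∣ β ^ 2 - NumberField.discr K → ¬ (p : ℤ) ∣ Dt.c →
      ∀ (c : K ≃ₐ[ℚ] K), c ≠ 1 → ∀ [Module (ZMod p) (Vp W K p)],
      ∃ (ε₀ : Finset (AdmQ W K p) → Bool)
        (κ₀ : Finset {ℓ // Zhang2014.IsKolyvaginPrime (W.conductorNorm ℤ) W K p ℓ} → Finset (AdmQ W K p) → Vp W K p)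
        (lam : Finset {ℓ // Zhang2014.IsKolyvaginPrime (W.conductorNorm ℤ) W K p ℓ} → Finset (AdmQ W K p) → ZMod p)
        (n₀ : Finset (AdmQ W K p)),
        -- realisation at level `∅`
        (∀ m : Finset {ℓ // Zhang2014.IsKolyvaginPrime (W.conductorNorm ℤ) W K p ℓ},
          ∃ d : KolyvaginHeegnerData Dt β ι (∏ ℓ ∈ m, (ℓ : ℕ)), κ₀ m ∅ = d.kolyvaginClass (Fact.out : p.Prime) 1) ∧
        -- sign
        (∀ n : Finset (AdmQ W K p), n.Nonempty → Even n.card →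
          ∀ m : Finset {ℓ // Zhang2014.IsKolyvaginPrime (W.conductorNorm ℤ) W K p ℓ},
          conjAct W c ((p ^ 1 : ℕ) : ℤ) (κ₀ m n) = sgnP (ε₀ n ^^ Nat.bodd m.card) • κ₀ m n) ∧
        -- selmer_off
        (∀ n : Finset (AdmQ W K p), n.Nonempty → Even n.card →
          ∀ (m : Finset {ℓ // Zhang2014.IsKolyvaginPrime (W.conductorNorm ℤ) W K p ℓ}) (v : HeightOneSpectrum (𝓞 K)),
          (∀ ℓ ∈ m, ((ℓ : ℕ) : 𝓞 K) ∉ v.asIdeal) → (∀ q ∈ n, ((q : ℕ) : 𝓞 K) ∉ v.asIdeal) →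
          κ₀ m n ∈ selmerLocalKer (W.baseChange K) (v.adicCompletion K) ((p ^ 1 : ℕ) : ℤ)) ∧
        -- selmer_inf
        (∀ n : Finset (AdmQ W K p), n.Nonempty → Even n.card →
          ∀ (m : Finset {ℓ // Zhang2014.IsKolyvaginPrime (W.conductorNorm ℤ) W K p ℓ}) (w : InfinitePlace K),
          κ₀ m n ∈ selmerLocalKer (W.baseChange K) w.Completion ((p ^ 1 : ℕ) : ℤ)) ∧
        -- toric_on
        (∀ n : Finset (AdmQ W K p), n.Nonempty → Even n.card →
          ∀ m : Finset {ℓ // Zhang2014.IsKolyvaginPrime (W.conductorNorm ℤ) W K p ℓ}, ∀ q ∈ n,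
          ∀ v : HeightOneSpectrum (𝓞 K), ((q : ℕ) : 𝓞 K) ∈ v.asIdeal →
          κ₀ m n ∈ toricLocalKer (W.baseChange K) (v.adicCompletion K) ((p ^ 1 : ℕ) : ℤ)) ∧
        -- transverse_on
        (∀ n : Finset (AdmQ W K p), n.Nonempty → Even n.card →
          ∀ m : Finset {ℓ // Zhang2014.IsKolyvaginPrime (W.conductorNorm ℤ) W K p ℓ}, ∀ ℓ ∈ m,
          ∀ v : HeightOneSpectrum (𝓞 K), ((ℓ : ℕ) : 𝓞 K) ∈ v.asIdeal → κ₀ m n ∈ transverseLocalKerP W K p ι ℓ v) ∧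
        -- relation (8.1)
        (∀ n : Finset (AdmQ W K p), n.Nonempty → Even n.card →
          ∀ (m : Finset {ℓ // Zhang2014.IsKolyvaginPrime (W.conductorNorm ℤ) W K p ℓ})
            (ℓ : {ℓ // Zhang2014.IsKolyvaginPrime (W.conductorNorm ℤ) W K p ℓ}), ℓ ∉ m →
          ∀ v : HeightOneSpectrum (𝓞 K), ((ℓ : ℕ) : 𝓞 K) ∈ v.asIdeal →
          (κ₀ (insert ℓ m) n ∈ (W.baseChange K).torsionLocalKer (v.adicCompletion K) ((p ^ 1 : ℕ) : ℤ) ↔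
            κ₀ m n ∈ (W.baseChange K).torsionLocalKer (v.adicCompletion K) ((p ^ 1 : ℕ) : ℤ))) ∧
        -- law (A), TWO-SIDED: the value one level up is a unit iff the class is detected at the NEW prime
        (∀ (n : Finset (AdmQ W K p)) (q : AdmQ W K p), Even n.card → q ∉ n →
          ∀ m : Finset {ℓ // Zhang2014.IsKolyvaginPrime (W.conductorNorm ℤ) W K p ℓ},
          lam m (insert q n) ≠ 0 ↔ ∃ v : HeightOneSpectrum (𝓞 K), ((q : ℕ) : 𝓞 K) ∈ v.asIdeal ∧
            κ₀ m n ∉ (W.baseChange K).torsionLocalKer (v.adicCompletion K) ((p ^ 1 : ℕ) : ℤ)) ∧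
        -- law (B), TWO-SIDED: the class is detected at a LEVEL prime iff the value one level down is a unit
        (∀ (n : Finset (AdmQ W K p)) (q : AdmQ W K p), Odd n.card → q ∉ n →
          ∀ m : Finset {ℓ // Zhang2014.IsKolyvaginPrime (W.conductorNorm ℤ) W K p ℓ},
          (∃ v : HeightOneSpectrum (𝓞 K), ((q : ℕ) : 𝓞 K) ∈ v.asIdeal ∧
            κ₀ m (insert q n) ∉ (W.baseChange K).torsionLocalKer (v.adicCompletion K) ((p ^ 1 : ℕ) : ℤ)) ↔
            lam m n ≠ 0) ∧
        -- selmer_bottom: the conductor-one bottom class is a signed Selmer class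
        (∃ μ : Bool, κ₀ ∅ ∅ ∈ SelQP W K p c ∅ μ) ∧
        -- ONE seed at a level of total canonical rank ≤ 1
        finrank (ZMod p) (SelQP W K p c n₀ true) + finrank (ZMod p) (SelQP W K p c n₀ false) ≤ 1 ∧
        ((Even n₀.card ∧ κ₀ ∅ n₀ ≠ 0) ∨ (Odd n₀.card ∧ lam ∅ n₀ ≠ 0))) :
    LevelKolyvaginSystemsAdditive := by
  intro W _ _ _ p _ K _ _ Dt β ι h5 hadd hsurj hsp htwo htam hr hK hodd hlt hH hL hβ hcM c hc1 _
  obtain ⟨ε₀, κ₀, lam, n₀, hreal, hsign, hoff, hinf, htor, htr, hrel, hA, hB, hbot, hcore₀, hseed⟩ :=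
    H W p K Dt β ι h5 hadd hsurj hsp htwo htam hr hK hodd hlt hH hL hβ hcM c hc1
  -- parity of `dim Sel_p(E/K)` from the published inputs, in the `SelQP ∅` currency
  have hp : p.Prime := Fact.out
  have hp2 : p ≠ 2 := by omega
  have hpar : Odd (finrank (ZMod p) (SelQP W K p c ∅ true) + finrank (ZMod p) (SelQP W K p c ∅ false)) := by
    obtain ⟨s, hsodd, hs⟩ := oddSelmerRankAdditive_of_levelInputs hPUB.1 hPUB.2.1 hPUB.2.2.2.2.1 hDual.1 W p K Dt β ι
      h5 hadd hsurj hsp htwo htam hr hK hodd hH hL hβ hcM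
    have e1 : ((p ^ 1 : ℕ) : ℤ) = (p : ℤ) := by simp
    have hs' : Nat.card (selmerGroup (W.baseChange K) ((p ^ 1 : ℕ) : ℤ)) = p ^ s := by rw [e1]; exact hs
    have hcard := natCard_selmer_eq_pow_finrank_selQP_add W K p hp2 hK c (Method2.algEquiv_mul_self_eq_one K hK c)
    rw [hs'] at hcard
    rwa [← Nat.pow_right_injective hp.two_le hcard]
  exact nonempty_levelKolyvaginSystemP_of_bipartite_of_seed_at_frame W K p c Dt β ι h5 hadd hsurj hK hH hc1 ε₀ κ₀ lam
    hreal hsign hoff hinf htor htr hrel hA hB hbot n₀ hcore₀ hseed (hR W p K c h5 hK hc1) hpar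

end Summit.BirchSwinnertonDyer.BirchSwinnertonDyer.Theorems.AdditiveKoly

end
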